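import Summits.ValiantsHypothesis.ValiantsHypothesis.Theorems.BarrierLeverChowThinRowsBallEntries
import Summits.ValiantsHypothesis.ValiantsHypothesis.Theorems.BarrierLeverChowThinRowsFormsPairPackaging

/-!
# Route BarrierLever — item `ChowHitsThinRowPartitionMinors` (stmt-ValiantsHypothesis-20195):
# the PAIR LAYER on HAMMING-BALL columns (stars, CO-STARS, mixed), every height

Helper file (`--supports stmt-ValiantsHypothesis-20195`; cell valiant-natproofs, rung V4, 𝒟-side of
door (c); prover seat val-np-p8 gen 2).  Closes NO item; imports `…ChowThinRowsBallEntries` (val-np-p8 g2: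
closed forms of the doubled singleton design) and `…ChowThinRowsFormsPairPackaging` (`exists_forms_of_card_le_pair`); no route file, no definitions.

**Theorem `chowHits_thinRows_ballColumns`.**  For every `h ≥ 1`, all injective thin rows `u i`
(`|u i| ≤ 2`) one of which is `∅`, every base point `p ⊆ Fin h`, and all injective columns inside the
HAMMING BALL of radius `1` around `p` (`w j ∈ {p} ∪ {p + c : c ∉ p} ∪ {p − c : c ∈ p}`, with at least
one inward direction unused when `p = ⊤`), ONE explicit rational product of `h + h` affine forms makes the
partition minor nonsingular.  `p = ∅` is the star of `…ChowThinRowsStarColumns`; `p = 𝟙_T` with inward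
directions gives the CO-STARS (the «co-weight ≤ 1» Leibniz columns of planner g15's MEMO-normalforms §7.2,
on which every product-of-pure-factors design is dead); mixed balls interpolate.

**The witness (p-BALANCED HADAMARD design, DOUBLED inward factors).**  Forms `φ_c = 1 + y_c +
Σ_a [a ∈ u(π j_c)] x_a` for every `c` (`j_c` = the column in direction `c`; `π` pairs the centre column
with the empty row), the balancing form `φ_∅` (`Σ_V κ_a(V) = ½K_a`, `K_a` = inward mass: singleton rows
vanish at the centre), and a second pure factor `1 + y_c` for every inward direction (Hadamard coefficient
`3` instead of `1` — reflecting a coordinate flips the sign of the Hadamard term).  Rows (`dbl_entry_*`):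
`∅ ↦ 2^{t_j}`, `{a} ↦ 2^{t_j}{0,½,−1}[a ∈ u(π j)]`, `{a,b} ↦ 2^{t_j}(c_ab/4 + {0,−½,2}[u(π j) = {a,b}])`.

WHAT THIS IS NOT: rows without `∅` / columns outside a radius-1 ball are not treated; items 20195 /
20172 / 19717 are NOT proved; nothing on crux stmt-ValiantsHypothesis-14610 or `VP ≠ VNP`. -/

set_option linter.dupNamespace false

namespace Summit.ValiantsHypothesis.ValiantsHypothesis.Theorems.BarrierLever.ChowSubcube

open Finset MvPolynomial
open Summit.ValiantsHypothesis.ValiantsHypothesis.Theorems.BarrierLever.ChowFactor (totalDegree_affine_le)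

variable {h : ℕ}

/-! ## 2. The theorem: thin rows containing `∅` × Hamming-ball columns, every height -/

/-- **Thin-row CPM on HAMMING-BALL columns, every height `h ≥ 1`** (item `ChowHitsThinRowPartitionMinors`,
stmt-ValiantsHypothesis-20195, on the layouts: rows of size `≤ 2` including the empty row; columns in the
radius-`1` ball `{p} ∪ {p + c} ∪ {p − c}` around a base point `p`, with some inward direction unused):
ONE explicit rational product of `h + h` affine forms — the `p`-balanced Hadamard design with doubled
inward pure factors — makes the partition minor nonsingular.  `p = ∅`: stars; `p ⊇` all directions:
CO-STARS (the co-weight-`≤ 1` Leibniz columns). -/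
theorem chowHits_thinRows_ballColumns (h : ℕ) (hh : 1 ≤ h) (r : ℕ) (u w : Fin r → Finset (Fin h))
    (hu : Function.Injective u) (hw : Function.Injective w)
    (hu2 : ∀ i, (u i).card ≤ 2) (h0 : ∃ i₀, u i₀ = ∅) (p : Finset (Fin h))
    (hball : ∀ j, w j = p ∨ ∃ c, (c ∉ p ∧ w j = insert c p) ∨ (c ∈ p ∧ w j = p.erase c))
    (hroom : ∃ c₀ : Fin h, c₀ ∉ p ∨ ∀ j, w j ≠ p.erase c₀) :
    ∃ ℓ : Fin (h + h) → MvPolynomial (Fin (h + h)) ℂ, (∀ k, (ℓ k).totalDegree ≤ 1) ∧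
      (Matrix.of fun i j : Fin r => MvPolynomial.coeff
        (∑ a ∈ u i, Finsupp.single (Fin.castAdd h a) 1 +
          ∑ c ∈ w j, Finsupp.single (Fin.natAdd h c) 1) (∏ k, ℓ k)).det ≠ 0 := by
  classical
  obtain ⟨i₀, hi₀⟩ := h0
  -- shapes of rows
  have hucases : ∀ i, u i ≠ ∅ → (∃ a, u i = {a}) ∨ ∃ a b, a ≠ b ∧ u i = {a, b} := by
    intro i hi
    have hpos : 0 < (u i).card := Finset.card_pos.mpr (Finset.nonempty_iff_ne_empty.mpr hi)
    rcases Nat.lt_or_ge (u i).card 2 with hlt | hge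
    · exact Or.inl (Finset.card_eq_one.mp (by omega))
    · exact Or.inr (Finset.card_eq_two.mp (le_antisymm (hu2 i) hge))
  have hune : ∀ i, i ≠ i₀ → u i ≠ ∅ := fun i hi e => hi (hu (e.trans hi₀.symm))
  -- directions of the non-central columns
  have hins_ne : ∀ c, c ∉ p → insert c p ≠ p := fun c hc e => hc (e ▸ Finset.mem_insert_self c p)
  have hera_ne : ∀ c, c ∈ p → p.erase c ≠ p := fun c hc e => (Finset.notMem_erase c p) (e.symm ▸ hc)
  have hdir_j : ∀ j j' c, ((c ∉ p ∧ w j = insert c p) ∨ (c ∈ p ∧ w j = p.erase c)) →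
      ((c ∉ p ∧ w j' = insert c p) ∨ (c ∈ p ∧ w j' = p.erase c)) → j = j' := by
    intro j j' c h1 h2
    rcases h1 with ⟨hc, e⟩ | ⟨hc, e⟩ <;> rcases h2 with ⟨hc', e'⟩ | ⟨hc', e'⟩
    · exact hw (e.trans e'.symm)
    · exact absurd hc' hc
    · exact absurd hc hc'
    · exact hw (e.trans e'.symm)
  -- the pairing `π`: the central column (if any) is sent to the empty row
  let j₁ : Fin r := if hW : ∃ j, w j = p then hW.choose else i₀
  let π : Equiv.Perm (Fin r) := Equiv.swap j₁ i₀
  have hπj : ∀ j, w j = p → π j = i₀ := by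
    intro j hj
    have hW : ∃ j, w j = p := ⟨j, hj⟩
    have hj₁ : j₁ = j := by
      have e : w hW.choose = p := hW.choose_spec
      simp only [j₁, dif_pos hW]
      exact hw (e.trans hj.symm)
    rw [← hj₁]
    exact Equiv.swap_apply_left _ _
  have hwne : ∀ i, u i ≠ ∅ → w (π.symm i) ≠ p := by
    intro i hi hcontra
    have e := hπj (π.symm i) hcontra
    rw [Equiv.apply_symm_apply] at e
    exact hi (by rw [e]; exact hi₀)
  -- the index family of the indicator forms: `∅` and all singletons
  set 𝒦 : Finset (Finset (Fin h)) := insert ∅ ((Finset.univ : Finset (Fin h)).image fun c => ({c} : Finset (Fin h)))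
    with h𝒦
  have h0K : (∅ : Finset (Fin h)) ∉ (Finset.univ : Finset (Fin h)).image (fun c => ({c} : Finset (Fin h))) := by
    intro hm
    obtain ⟨c, -, e⟩ := Finset.mem_image.mp hm
    exact Finset.singleton_ne_empty c e
  have h1 : ∀ V ∈ 𝒦, V.card ≤ 1 := by
    intro V hV
    rcases Finset.mem_insert.mp hV with e | hV'
    · rw [e, Finset.card_empty]; exact Nat.zero_le _
    · obtain ⟨c, -, rfl⟩ := Finset.mem_image.mp hV'
      rw [Finset.card_singleton]
  have hsing : ∀ c : Fin h, ({c} : Finset (Fin h)) ∈ 𝒦 := fun c =>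
    Finset.mem_insert_of_mem (Finset.mem_image.mpr ⟨c, Finset.mem_univ _, rfl⟩)
  -- the inward directions that occur
  set D : Finset (Fin h) := p.filter fun c => ∃ j, w j = p.erase c with hD
  have hDsub : D ⊆ p := Finset.filter_subset _ _
  have hcardD : D.card + 1 ≤ h := by
    obtain ⟨c₀, hc₀⟩ := hroom
    have hc₀D : c₀ ∉ D := by
      intro hm
      rcases hc₀ with hc₀ | hc₀
      · exact hc₀ (hDsub hm)
      · obtain ⟨j, hj⟩ := (Finset.mem_filter.mp hm).2
        exact hc₀ j hj
    have hsub : D ⊆ Finset.univ.erase c₀ := fun c hc =>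
      Finset.mem_erase.mpr ⟨fun e => hc₀D (e ▸ hc), Finset.mem_univ _⟩
    have := Finset.card_le_card hsub
    rw [Finset.card_erase_of_mem (Finset.mem_univ _), Finset.card_univ, Fintype.card_fin] at this
    omega
  have hcard : 𝒦.card + D.card ≤ h + h := by
    rw [h𝒦, Finset.card_insert_of_notMem h0K,
      Finset.card_image_of_injective _ (fun c c' (e : ({c} : Finset (Fin h)) = {c'}) => Finset.singleton_injective e),
      Finset.card_univ, Fintype.card_fin]
    omega
  -- the `p`-balanced Hadamard design with doubled inward factors
  let kc : Fin h → Fin h → ℂ := fun a c =>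
    ((Finset.univ.filter fun j => ((c ∉ p ∧ w j = insert c p) ∨ (c ∈ p ∧ w j = p.erase c)) ∧ a ∈ u (π j)).card : ℂ)
  let K : Fin h → ℂ := fun a => ∑ c ∈ D, kc a c
  let κ : Fin h → Finset (Fin h) → ℂ := fun a V =>
    if V = ∅ then (1 / 2 : ℂ) * K a - ∑ c, kc a c else ∑ c ∈ V, kc a c
  have hκsing : ∀ a c, κ a {c} = kc a c := fun a c => by
    simp only [κ, if_neg (Finset.singleton_ne_empty c), Finset.sum_singleton]
  have hA : ∀ a, ∑ V ∈ 𝒦, κ a V = (1 / 2 : ℂ) * K a := by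
    intro a
    rw [h𝒦, Finset.sum_insert h0K,
      Finset.sum_image fun c _ c' _ (e : ({c} : Finset (Fin h)) = {c'}) => Finset.singleton_injective e]
    simp only [hκsing]
    simp only [κ, if_pos rfl]
    ring
  -- `kc a c` vanishes unless `c` is a direction of some column; then it is the indicator `[a ∈ u (π j)]`
  have hkcW : ∀ j a c, ((c ∉ p ∧ w j = insert c p) ∨ (c ∈ p ∧ w j = p.erase c)) →
      kc a c = if a ∈ u (π j) then 1 else 0 := by
    intro j a c hj
    simp only [kc]
    by_cases ha : a ∈ u (π j)
    · rw [if_pos ha]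
      have e : (Finset.univ.filter fun j' =>
          ((c ∉ p ∧ w j' = insert c p) ∨ (c ∈ p ∧ w j' = p.erase c)) ∧ a ∈ u (π j')) = {j} := by
        ext j'
        simp only [Finset.mem_filter, Finset.mem_univ, true_and, Finset.mem_singleton]
        exact ⟨fun hh' => hdir_j j' j c hh'.1 hj, fun e => by subst e; exact ⟨hj, ha⟩⟩
      rw [e, Finset.card_singleton, Nat.cast_one]
    · rw [if_neg ha]
      have e : (Finset.univ.filter fun j' =>
          ((c ∉ p ∧ w j' = insert c p) ∨ (c ∈ p ∧ w j' = p.erase c)) ∧ a ∈ u (π j')) = ∅ :=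
        Finset.filter_eq_empty_iff.mpr fun j' _ hh' => ha (by rw [← hdir_j j' j c hh'.1 hj]; exact hh'.2)
      rw [e, Finset.card_empty, Nat.cast_zero]
  have hkc0 : ∀ a c, c ∈ p → c ∉ D → kc a c = 0 := by
    intro a c hcp hcD
    simp only [kc]
    have e : (Finset.univ.filter fun j' =>
        ((c ∉ p ∧ w j' = insert c p) ∨ (c ∈ p ∧ w j' = p.erase c)) ∧ a ∈ u (π j')) = ∅ := by
      refine Finset.filter_eq_empty_iff.mpr fun j' _ hh' => ?_
      rcases hh'.1 with ⟨hc, -⟩ | ⟨-, e⟩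
      · exact hc hcp
      · exact hcD (Finset.mem_filter.mpr ⟨hcp, j', e⟩)
    rw [e, Finset.card_empty, Nat.cast_zero]
  have hkk : ∀ j a b c, a ≠ b → ((c ∉ p ∧ w j = insert c p) ∨ (c ∈ p ∧ w j = p.erase c)) →
      kc a c * kc b c = if u (π j) = {a, b} then 1 else 0 := by
    intro j a b c hab hj
    rw [hkcW j a c hj, hkcW j b c hj]
    by_cases hab' : u (π j) = {a, b}
    · rw [if_pos hab', if_pos (by rw [hab']; simp), if_pos (by rw [hab']; simp), mul_one]
    · rw [if_neg hab']
      by_cases ha : a ∈ u (π j)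
      · by_cases hb : b ∈ u (π j)
        · exfalso
          refine hab' (Finset.eq_of_subset_of_card_le (fun x hx => ?_) ?_).symm
          · rcases Finset.mem_insert.mp hx with e | e
            · rw [e]; exact ha
            · rw [Finset.mem_singleton.mp e]; exact hb
          · rw [Finset.card_pair hab]; exact hu2 _
        · rw [if_neg hb, mul_zero]
      · rw [if_neg ha, zero_mul]
  -- sums over the base point: only the inward directions contribute
  have hsum_p : ∀ f : Fin h → ℂ, (∀ c, c ∈ p → c ∉ D → f c = 0) → ∑ c ∈ p, f c = ∑ c ∈ D, f c := by
    intro f hf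
    rw [hD, Finset.sum_filter]
    refine Finset.sum_congr rfl fun c hc => ?_
    by_cases hP : ∃ j, w j = p.erase c
    · rw [if_pos hP]
    · rw [if_neg hP]
      exact hf c hc (fun hm => hP (Finset.mem_filter.mp hm).2)
  have hKp : ∀ a, ∑ c ∈ p, kc a c = K a := fun a => hsum_p _ (fun c hc hcD => hkc0 a c hc hcD)
  have hHp : ∀ a b, ∑ c ∈ p, kc a c * kc b c = ∑ c ∈ D, kc a c * kc b c := fun a b =>
    hsum_p _ (fun c hc hcD => by rw [hkc0 a c hc hcD, zero_mul])
  have hpD : p ∩ D = D := Finset.inter_eq_right.mpr hDsub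
  have hinsD : ∀ c, c ∉ p → insert c p ∩ D = D := fun c hc => by
    rw [Finset.insert_inter_of_notMem (fun hm => hc (hDsub hm)), hpD]
  have heraD : ∀ c, (p.erase c) ∩ D = D.erase c := fun c => by
    ext x
    simp only [Finset.mem_inter, Finset.mem_erase]
    constructor
    · rintro ⟨⟨hx, -⟩, hxD⟩; exact ⟨hx, hxD⟩
    · rintro ⟨hx, hxD⟩; exact ⟨⟨hx, hDsub hxD⟩, hxD⟩
  have hDmem : ∀ c j, c ∈ p → w j = p.erase c → c ∈ D := fun c j hc hj =>
    Finset.mem_filter.mpr ⟨hc, j, hj⟩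
  -- the forms and their embedding into `Fin (h + h)`
  obtain ⟨ℓ, hℓdeg, hℓprod⟩ := exists_forms_of_card_le_pair 𝒦 D hcard
    (fun V => C 1 + ∑ a, C (κ a V) * X (Fin.castAdd h a) +
      ∑ c, C (if c ∈ V then (1 : ℂ) else 0) * X (Fin.natAdd h c))
    (fun V _ => by
      have e : (C 1 + ∑ a, C (κ a V) * X (Fin.castAdd h a) +
          ∑ c, C (if c ∈ V then (1 : ℂ) else 0) * X (Fin.natAdd h c) : MvPolynomial (Fin (h + h)) ℂ) =
          C 1 + ∑ v : Fin (h + h), C (Fin.append (fun a => κ a V)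
            (fun c => if c ∈ V then (1 : ℂ) else 0) v) * X v := by
        rw [Fin.sum_univ_add]
        simp only [Fin.append_left, Fin.append_right, add_assoc]
      rw [e]
      exact totalDegree_affine_le _ _)
  refine ⟨ℓ, hℓdeg, ?_⟩
  rw [hℓprod]
  set M : Matrix (Fin r) (Fin r) ℂ := Matrix.of fun i j : Fin r => MvPolynomial.coeff
      (∑ a ∈ u i, Finsupp.single (Fin.castAdd h a) 1 + ∑ c ∈ w j, Finsupp.single (Fin.natAdd h c) 1)
      ((∏ V ∈ 𝒦, (C 1 + ∑ a, C (κ a V) * X (Fin.castAdd h a) +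
        ∑ c, C (if c ∈ V then (1 : ℂ) else 0) * X (Fin.natAdd h c))) *
        ∏ c ∈ D, (C 1 + X (Fin.natAdd h c))) with hM
  -- signs of the columns: `σ₁` for singleton rows, `σ₂` for pair rows
  let σ₁ : Fin r → ℂ := fun j => if w j = p then 0 else if p ⊆ w j then -2 else 1
  let σ₂ : Fin r → ℂ := fun j => if w j = p then 0 else if p ⊆ w j then 8 else -2
  have hσ₁ne : ∀ j, w j ≠ p → σ₁ j ≠ 0 := fun j hj => by
    simp only [σ₁, if_neg hj]; split_ifs <;> norm_num
  have hσ₂ne : ∀ j, w j ≠ p → σ₂ j ≠ 0 := fun j hj => by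
    simp only [σ₂, if_neg hj]; split_ifs <;> norm_num
  -- Step 1: the entries
  have hrow0 : ∀ j, M i₀ j = 2 ^ ((w j) ∩ D).card := by
    intro j
    rw [hM, Matrix.of_apply, hi₀, dbl_entry_empty κ 𝒦 h1 hsing D (w j)]
  have hrow1 : ∀ i a, u i = {a} → ∀ j,
      2 * M i j = 2 ^ ((w j) ∩ D).card * (σ₁ j * (if a ∈ u (π j) then 1 else 0)) := by
    intro i a hia j
    rw [hM, Matrix.of_apply, hia, dbl_entry_single κ 𝒦 h1 hsing D (w j) a, hA a]
    simp only [hκsing]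
    rcases hball j with hj | ⟨c, ⟨hc, hj⟩ | ⟨hc, hj⟩⟩
    · have hs : σ₁ j = 0 := by simp only [σ₁, if_pos hj]
      rw [hs, hj, hpD, hKp a]
      ring
    · have hs : σ₁ j = -2 := by
        simp only [σ₁, if_neg (hj ▸ hins_ne c hc : w j ≠ p), hj, if_pos (Finset.subset_insert c p)]
      rw [hs, hj, hinsD c hc, Finset.sum_insert hc, hKp a, hkcW j a c (Or.inl ⟨hc, hj⟩)]
      ring
    · have hs : σ₁ j = 1 := by
        have hns : ¬ p ⊆ p.erase c := fun hsub => Finset.notMem_erase c p (hsub hc)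
        simp only [σ₁, if_neg (hj ▸ hera_ne c hc : w j ≠ p), hj, if_neg hns]
      rw [hs, hj, heraD c, Finset.sum_erase_eq_sub hc, Finset.sum_erase_eq_sub (hDmem c j hc hj), hKp a,
        hkcW j a c (Or.inr ⟨hc, hj⟩)]
      ring
  have hrow2 : ∀ i a b, a ≠ b → u i = {a, b} → ∀ j,
      4 * M i j = 2 ^ ((w j) ∩ D).card *
        ((3 * ∑ c ∈ D, kc a c * kc b c - 4 * ∑ V ∈ 𝒦, κ a V * κ b V) +
          σ₂ j * (if u (π j) = {a, b} then 1 else 0)) := by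
    intro i a b hab hiab j
    rw [hM, Matrix.of_apply, hiab, dbl_entry_pair κ 𝒦 h1 hsing D (w j) hab, hA a, hA b]
    simp only [hκsing]
    rcases hball j with hj | ⟨c, ⟨hc, hj⟩ | ⟨hc, hj⟩⟩
    · have hs : σ₂ j = 0 := by simp only [σ₂, if_pos hj]
      rw [hs, hj, hpD, hKp a, hKp b, hHp a b]
      ring
    · have hs : σ₂ j = 8 := by
        simp only [σ₂, if_neg (hj ▸ hins_ne c hc : w j ≠ p), hj, if_pos (Finset.subset_insert c p)]
      rw [hs, hj, hinsD c hc, Finset.sum_insert hc, Finset.sum_insert hc, Finset.sum_insert hc,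
        hKp a, hKp b, hHp a b, ← hkk j a b c hab (Or.inl ⟨hc, hj⟩)]
      ring
    · have hs : σ₂ j = -2 := by
        have hns : ¬ p ⊆ p.erase c := fun hsub => Finset.notMem_erase c p (hsub hc)
        simp only [σ₂, if_neg (hj ▸ hera_ne c hc : w j ≠ p), hj, if_neg hns]
      have hcD := hDmem c j hc hj
      rw [hs, hj, heraD c, Finset.sum_erase_eq_sub hc, Finset.sum_erase_eq_sub hc, Finset.sum_erase_eq_sub hc,
        Finset.sum_erase_eq_sub hcD, Finset.sum_erase_eq_sub hcD, Finset.sum_erase_eq_sub hcD,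
        hKp a, hKp b, hHp a b, ← hkk j a b c hab (Or.inr ⟨hc, hj⟩)]
      ring
  -- Step 2: `M v = 0 ⇒ v = 0`
  have h2ne : ∀ n : ℕ, (2 : ℂ) ^ n ≠ 0 := fun n => pow_ne_zero n two_ne_zero
  have hker : ∀ v : Fin r → ℂ, M.mulVec v = 0 → v = 0 := by
    intro v hv
    have hvrow : ∀ i, ∑ j, M i j * v j = 0 := fun i => by
      have := congr_fun hv i
      simpa [Matrix.mulVec, dotProduct] using this
    -- the empty row: Σ_j 2^{t_j} v_j = 0
    have hsum : ∑ j, 2 ^ ((w j) ∩ D).card * v j = 0 := by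
      have := hvrow i₀
      simpa [hrow0] using this
    have hind : ∀ i, u i ≠ ∅ → ∀ j, ((w j ≠ p ∧ u (π j) = u i) ↔ j = π.symm i) := by
      intro i hi j
      constructor
      · intro hh'
        rw [Equiv.eq_symm_apply]
        exact hu hh'.2
      · intro e
        subst e
        exact ⟨hwne i hi, by rw [Equiv.apply_symm_apply]⟩
    -- pair rows
    have hpair : ∀ i a b, a ≠ b → u i = {a, b} → v (π.symm i) = 0 := by
      intro i a b hab hiab
      have hi : u i ≠ ∅ := by rw [hiab]; exact Finset.insert_ne_empty a {b}
      have hterm : ∀ j, 2 ^ ((w j) ∩ D).card * σ₂ j * (if u (π j) = {a, b} then (1 : ℂ) else 0) * v j =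
          if j = π.symm i then 2 ^ ((w j) ∩ D).card * σ₂ j * v j else 0 := by
        intro j
        by_cases hj : j = π.symm i
        · rw [if_pos hj, if_pos (((hind i hi j).mpr hj).2.trans hiab), mul_one]
        · by_cases hw' : w j = p
          · have hs : σ₂ j = 0 := by simp only [σ₂, if_pos hw']
            rw [hs, if_neg hj]; ring
          · rw [if_neg hj, if_neg (fun hh' => hj ((hind i hi j).mp ⟨hw', hh'.trans hiab.symm⟩))]; ring
      have e := hvrow i
      have e4 : ∑ j, (4 * M i j) * v j = 0 := by
        have : ∑ j, (4 * M i j) * v j = 4 * ∑ j, M i j * v j := by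
          rw [Finset.mul_sum]; exact Finset.sum_congr rfl fun j _ => by ring
        rw [this, e, mul_zero]
      rw [Finset.sum_congr rfl (fun j _ => by rw [hrow2 i a b hab hiab j])] at e4
      set cab : ℂ := 3 * ∑ c ∈ D, kc a c * kc b c - 4 * ∑ V ∈ 𝒦, κ a V * κ b V with hcab
      have key : ∑ j, 2 ^ ((w j) ∩ D).card *
          (cab + σ₂ j * (if u (π j) = {a, b} then 1 else 0)) * v j =
          cab * ∑ j, 2 ^ ((w j) ∩ D).card * v j +
            ∑ j, 2 ^ ((w j) ∩ D).card * σ₂ j * (if u (π j) = {a, b} then (1 : ℂ) else 0) * v j := by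
        rw [Finset.mul_sum Finset.univ (fun j => 2 ^ ((w j) ∩ D).card * v j) cab, ← Finset.sum_add_distrib]
        exact Finset.sum_congr rfl fun j _ => by ring
      rw [key, hsum, mul_zero, zero_add, Finset.sum_congr rfl fun j _ => hterm j,
        Finset.sum_ite_eq' Finset.univ (π.symm i), if_pos (Finset.mem_univ _)] at e4
      rcases mul_eq_zero.mp e4 with h' | h'
      · rcases mul_eq_zero.mp h' with h'' | h''
        · exact absurd h'' (h2ne _)
        · exact absurd h'' (hσ₂ne _ (hwne i hi))
      · exact h'
    -- singleton rows
    have hsingle : ∀ i a, u i = {a} → v (π.symm i) = 0 := by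
      intro i a hia
      have hi : u i ≠ ∅ := by rw [hia]; exact Finset.singleton_ne_empty a
      have e := hvrow i
      have e2 : ∑ j, (2 * M i j) * v j = 0 := by
        have : ∑ j, (2 * M i j) * v j = 2 * ∑ j, M i j * v j := by
          rw [Finset.mul_sum]; exact Finset.sum_congr rfl fun j _ => by ring
        rw [this, e, mul_zero]
      rw [Finset.sum_congr rfl (fun j _ => by rw [hrow1 i a hia j])] at e2
      -- reindex the sum through `π`
      have hre : ∑ j, 2 ^ ((w j) ∩ D).card * (σ₁ j * (if a ∈ u (π j) then (1 : ℂ) else 0)) * v j =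
          ∑ i', 2 ^ ((w (π.symm i')) ∩ D).card *
            (σ₁ (π.symm i') * (if a ∈ u i' then (1 : ℂ) else 0)) * v (π.symm i') := by
        rw [← Equiv.sum_comp π.symm]
        simp only [Equiv.apply_symm_apply]
      rw [hre, Finset.sum_eq_single i] at e2
      · rw [if_pos (by rw [hia]; exact Finset.mem_singleton_self a), mul_one] at e2
        rcases mul_eq_zero.mp e2 with h' | h'
        · rcases mul_eq_zero.mp h' with h'' | h''
          · exact absurd h'' (h2ne _)
          · exact absurd h'' (hσ₁ne _ (hwne i hi))
        · exact h'
      · intro i' _ hi'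
        by_cases ha : a ∈ u i'
        · have hne : u i' ≠ ∅ := Finset.ne_empty_of_mem ha
          rcases hucases i' hne with ⟨a', ha'⟩ | ⟨a', b', hab', hab''⟩
          · exfalso
            apply hi'
            apply hu
            rw [ha', Finset.mem_singleton] at ha
            rw [ha', hia, ha]
          · rw [hpair i' a' b' hab' hab'', mul_zero]
        · rw [if_neg ha, mul_zero, mul_zero, zero_mul]
      · intro hi'; exact absurd (Finset.mem_univ i) hi'
    have hval : ∀ i, i ≠ i₀ → v (π.symm i) = 0 := by
      intro i hi
      rcases hucases i (hune i hi) with ⟨a, ha⟩ | ⟨a, b, hab, hab'⟩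
      · exact hsingle i a ha
      · exact hpair i a b hab hab'
    have hlast : v (π.symm i₀) = 0 := by
      rw [Finset.sum_eq_single (π.symm i₀) (fun j _ hj => ?_) (fun hh' => absurd (Finset.mem_univ _) hh')] at hsum
      · rcases mul_eq_zero.mp hsum with h' | h'
        · exact absurd h' (h2ne _)
        · exact h'
      · have e : j = π.symm (π j) := by rw [Equiv.symm_apply_apply]
        rw [e, hval (π j) (fun hh' => hj (by rw [e, hh'])), mul_zero]
    funext j
    have e : j = π.symm (π j) := by rw [Equiv.symm_apply_apply]
    rw [e, Pi.zero_apply]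
    by_cases hj : π j = i₀
    · rw [hj]; exact hlast
    · exact hval (π j) hj
  -- Step 3: conclude
  have hinj : Function.Injective M.mulVec := fun v₁ v₂ hv => by
    rw [← sub_eq_zero]; exact hker (v₁ - v₂) (by rw [Matrix.mulVec_sub, hv, sub_self])
  exact ((Matrix.isUnit_iff_isUnit_det M).mp (Matrix.mulVec_injective_iff_isUnit.mp hinj)).ne_zero

end Summit.ValiantsHypothesis.ValiantsHypothesis.Theorems.BarrierLever.ChowSubcube
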